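import Summits.QuantumAdvantage.QuantumAdvantage.Theorems.CubicForrelationNearExactIsExactIsolationSmallN
import HarnessLib

/-!
# Crux `CubicForrelation.NearExactIsExact` (stmt-QuantumAdvantage-14043): 2-adic digits of the Walsh transform
  of a type-O cubic on 9 bits

Block-2b certificate seat `b2b-cforr-cert` (2026-08-18).  HONEST FRAMING: these are lemmas for the finite slice
`n = 10` of the crux (the `θ = 7/8` rung), NOT summit progress.

For a cubic `F : 𝔽₂⁹ → 𝔽₂`, every Walsh value is a multiple of `8` (Ax/McEliece).  If every `W_F(x)/8 = u(x)` is
odd ("type O"), write `u = 2u₁ + 1`, `u₁ = 2u₂ + t` with `t = [u₁ odd]`.  Then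
* `nine_cube_sum_dvd`: `2^r ∣ Σ_{x ∈ E_I} u(x)` whenever `r + 3 ≤ |I| + ⌈(9 − |I|)/3⌉` (Poisson summation over the
  coordinate cube `E_I` + Ax's theorem on `E_{Iᶜ}`; the pattern of `stub_walshTower` with the exponent explicit);
* `nine_digit_two`: `x ↦ [u₁(x) odd]` is AFFINE (cubes with `|I| ≥ 2`);
* `nine_digit_three`: `x ↦ [u₂(x) odd]` is CUBIC (cubes with `|I| ≥ 4`, using that an affine function has weight
  `≡ 0 (mod 4)` on every cube of dimension `≥ 3` — Ax with `d = 1`).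
These are the `n = 9` analogues of `TypeOTwelve.digit_two` / `digit_three` (disprover seat, `n = 12`), used by the
discharge of the `n = 10` census (`…TenCensusDischarge.lean`): there they are applied to the restriction of the cubic
partner `f₁` to the heavy hyperplane of `g`.
Sources: J. Ax (1964) / R. McEliece (1972) (Carlet 2021 §4.1); MacWilliams–Sloane Ch. 13–15 (Reed–Muller weights,
Poisson summation).  Axioms: the standard three.
-/

set_option linter.dupNamespace false -- D-0017: single-problem summit ⇒ `QuantumAdvantage.QuantumAdvantage` by design

noncomputable section

namespace Summit.QuantumAdvantage.QuantumAdvantage.Theorems.CubicForrelation.NearExactIsExact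

open Finset
open Literature.Computability.QuantumComplexity
open Literature.Computability.QuantumComplexity.DerivativeWalsh (W)

section NineDigits

variable (F : (Fin (4 + 4 + 1) → Bool) → Bool) (u : (Fin (4 + 4 + 1) → Bool) → ℤ)

/-- The coordinate cube `E_I ⊆ 𝔽₂⁹` has `2^{|I|}` points (cast to `ℤ`). [folklore] -/
theorem nine_card_cube_int (I : Finset (Fin (4 + 4 + 1))) :
    (#({x : Fin (4 + 4 + 1) → Bool | ∀ i, x i = true → i ∈ I} : Finset _) : ℤ) = 2 ^ #I := by
  rw [bb_card_cube I]; push_cast; rfl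

/-- **Level-3 cube sums on 9 bits.** For cubic `F` on `9` bits with `W_F = 8·u`: `2^r ∣ Σ_{x ∈ E_I} u(x)` whenever
`r + 3 ≤ |I| + ⌈(9 − |I|)/3⌉` (Poisson summation over `E_I` + Ax's theorem on `E_{Iᶜ}`). [cite: Carlet2020, §4.1] -/
theorem nine_cube_sum_dvd (hF : IsDegLeFun 3 F) (hu : ∀ x, W (fun y => signOf (F y)) x = (2 : ℝ) ^ 3 * (u x : ℝ))
    (I : Finset (Fin (4 + 4 + 1))) (r : ℕ) (hr : r + 3 ≤ #I + (4 + 4 + 1 - #I + 2) / 3) :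
    (2 : ℤ) ^ r ∣ ∑ x ∈ {x : Fin (4 + 4 + 1) → Bool | ∀ i, x i = true → i ∈ I}, u x := by
  have hP := bb_poisson (fun y => signOf (F y)) I
  obtain ⟨z, hz⟩ := stub_axParity (4 + 4 + 1) 3 F Iᶜ (by norm_num) hF
  generalize hc : (Iᶜ.card + 3 - 1) / 3 = c at hz
  rw [sum_congr rfl fun x _ => hu x, ← mul_sum, hz] at hP
  have hk : #I ≤ 4 + 4 + 1 := (card_le_univ I).trans_eq (Fintype.card_fin _)
  have hj : #Iᶜ = 4 + 4 + 1 - #I := by rw [card_compl, Fintype.card_fin]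
  have hrc : r + 3 ≤ #I + c := by omega
  have hZ : (2 : ℤ) ^ 3 * ∑ x ∈ {x : Fin (4 + 4 + 1) → Bool | ∀ i, x i = true → i ∈ I}, u x =
      2 ^ #I * (2 ^ c * z) := by
    exact_mod_cast hP
  obtain ⟨e, he⟩ : ∃ e, #I + c = 3 + r + e := ⟨#I + c - 3 - r, by omega⟩
  refine ⟨2 ^ e * z, ?_⟩
  have h0 : (2 : ℤ) ^ 3 ≠ 0 := by positivity
  apply mul_left_cancel₀ h0
  rw [hZ, show (2 : ℤ) ^ #I * (2 ^ c * z) = 2 ^ (#I + c) * z by ring, he]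
  ring

/-- **The second 2-adic digit of a type-O cubic on 9 bits is affine.** If every `u(x)` is odd, `u = 2u₁ + 1`, then
`x ↦ [u₁(x) odd]` has algebraic degree `≤ 1`: for `|I| ≥ 2`, `4 ∣ Σ_{E_I} u = 2 Σ_{E_I} u₁ + 2^{|I|}`, so
`Σ_{E_I} u₁` is even; Möbius inversion. [cite: Carlet2020, §4.1] -/
theorem nine_digit_two (hF : IsDegLeFun 3 F) (hu : ∀ x, W (fun y => signOf (F y)) x = (2 : ℝ) ^ 3 * (u x : ℝ))
    (u₁ : (Fin (4 + 4 + 1) → Bool) → ℤ) (h1 : ∀ x, u x = 2 * u₁ x + 1) :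
    IsDegLeFun 1 (fun x => decide (Odd (u₁ x))) := by
  refine bb_moebius_isDegLeFun 1 _ fun I hI => ?_
  have hk : #I ≤ 4 + 4 + 1 := (card_le_univ I).trans_eq (Fintype.card_fin _)
  obtain ⟨k, hk4⟩ := nine_cube_sum_dvd F u hF hu I 2 (by omega)
  have hsum : ∑ x ∈ {x : Fin (4 + 4 + 1) → Bool | ∀ i, x i = true → i ∈ I}, u x =
      2 * ∑ x ∈ {x : Fin (4 + 4 + 1) → Bool | ∀ i, x i = true → i ∈ I}, u₁ x + 2 ^ #I := by
    rw [sum_congr rfl fun x _ => h1 x, sum_add_distrib, mul_sum, sum_const, nsmul_eq_mul, mul_one,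
      nine_card_cube_int]
  obtain ⟨a, ha⟩ : ∃ a, #I = a + 2 := ⟨#I - 2, by omega⟩
  rw [ha, pow_add, hk4] at hsum
  have hE : Even (∑ x ∈ {x : Fin (4 + 4 + 1) → Bool | ∀ i, x i = true → i ∈ I}, u₁ x) :=
    ⟨k - 2 ^ a, by linarith⟩
  have h := (tw_even_sum_iff _ u₁).1 hE
  rw [filter_filter] at h
  simpa only [decide_eq_true_eq] using h

/-- **The third 2-adic digit of a type-O cubic on 9 bits is cubic.** With `u = 2u₁ + 1`, `u₁ = 2u₂ + t`,
`t = [u₁ odd] ∈ {0,1}`: `x ↦ [u₂(x) odd]` has algebraic degree `≤ 3`: for `|I| ≥ 4`,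
`8 ∣ Σ_{E_I} u = 4 Σ u₂ + 2 Σ t + 2^{|I|}` and `4 ∣ Σ_{E_I} t` because `t` is an affine function restricted to a
cube of dimension `≥ 3` (Ax's theorem with `d = 1`). [cite: Carlet2020, §4.1] -/
theorem nine_digit_three (hF : IsDegLeFun 3 F) (hu : ∀ x, W (fun y => signOf (F y)) x = (2 : ℝ) ^ 3 * (u x : ℝ))
    (u₁ u₂ t : (Fin (4 + 4 + 1) → Bool) → ℤ) (h1 : ∀ x, u x = 2 * u₁ x + 1) (h2 : ∀ x, u₁ x = 2 * u₂ x + t x)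
    (ht : ∀ x, t x = if Odd (u₁ x) then 1 else 0) :
    IsDegLeFun 3 (fun x => decide (Odd (u₂ x))) := by
  have hτ : IsDegLeFun 1 (fun x => decide (Odd (u₁ x))) := nine_digit_two F u hF hu u₁ h1
  refine bb_moebius_isDegLeFun 3 _ fun I hI => ?_
  have hk : #I ≤ 4 + 4 + 1 := (card_le_univ I).trans_eq (Fintype.card_fin _)
  obtain ⟨k, hk8⟩ := nine_cube_sum_dvd F u hF hu I 3 (by omega)
  obtain ⟨z, hz⟩ := stub_axParity (4 + 4 + 1) 1 (fun x => decide (Odd (u₁ x))) I le_rfl hτ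
  have hexp : (#I + 1 - 1) / 1 = #I := by simp
  have hsign : ∀ x, signOf (decide (Odd (u₁ x))) = 1 - 2 * (t x : ℝ) := fun x => by
    rw [ht x]
    by_cases h : Odd (u₁ x)
    · simp [h, signOf]; norm_num
    · simp [h, signOf]
  rw [hexp, sum_congr rfl fun x _ => hsign x, sum_sub_distrib, sum_const, nsmul_eq_mul, mul_one, ← mul_sum] at hz
  have hcardR : ((#({x : Fin (4 + 4 + 1) → Bool | ∀ i, x i = true → i ∈ I} : Finset _) : ℕ) : ℝ) =
      (2 : ℝ) ^ #I := by
    rw [bb_card_cube I]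
    push_cast
    rfl
  rw [hcardR] at hz
  have hT : (2 : ℤ) ^ #I - 2 * ∑ x ∈ {x : Fin (4 + 4 + 1) → Bool | ∀ i, x i = true → i ∈ I}, t x = 2 ^ #I * z := by
    exact_mod_cast hz
  have hsum : ∑ x ∈ {x : Fin (4 + 4 + 1) → Bool | ∀ i, x i = true → i ∈ I}, u x =
      4 * ∑ x ∈ {x : Fin (4 + 4 + 1) → Bool | ∀ i, x i = true → i ∈ I}, u₂ x +
        2 * ∑ x ∈ {x : Fin (4 + 4 + 1) → Bool | ∀ i, x i = true → i ∈ I}, t x + 2 ^ #I := by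
    rw [sum_congr rfl fun x _ => by rw [h1 x, h2 x], sum_add_distrib, sum_const, nsmul_eq_mul, mul_one,
      nine_card_cube_int, mul_sum, mul_sum, ← sum_add_distrib]
    exact congrArg (· + _) (sum_congr rfl fun x _ => by ring)
  obtain ⟨a, ha⟩ : ∃ a, #I = a + 4 := ⟨#I - 4, by omega⟩
  rw [ha, pow_add] at hsum hT
  rw [hk8] at hsum
  have hE : Even (∑ x ∈ {x : Fin (4 + 4 + 1) → Bool | ∀ i, x i = true → i ∈ I}, u₂ x) :=
    ⟨k - 2 ^ a * (4 - 2 * z), by linarith⟩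
  have h := (tw_even_sum_iff _ u₂).1 hE
  rw [filter_filter] at h
  simpa only [decide_eq_true_eq] using h

end NineDigits

end Summit.QuantumAdvantage.QuantumAdvantage.Theorems.CubicForrelation.NearExactIsExact
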